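import Mathlib
import Summits.RiemannHypothesis.RiemannHypothesis.Theses.SpectralTrace

/-!
# Sketch — first lemmas of three levers for the crux `SpectralTrace.SpectralIsHpSpectrum`
(stmt-RiemannHypothesis-0195; crux-ideate round 1, ideator 2).

Card B `fejer-fatou-sandwich`   : B1–B5.
Card C `charfun-tilt`           : C1–C3.
Card D `resolvent-laplace-poles`: D1–D3.
Everything is stated over existing declarations; proofs are `sorry` (ideation stage, no skeleton).
-/

noncomputable section

open Complex MeasureTheory Filter Set
open scoped Topology ENNReal

namespace Summit.RiemannHypothesis.RiemannHypothesis.Cruxes.SpectralIsHpSpectrum.Sketch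

open Literature.NumberTheory.LFunctions

/-- The hypothesis of the crux: the real family `γ` reproduces the Weil functional on every test. -/
def IsWeilSpectrum {ι : Type} (γ : ι → ℝ) : Prop :=
  ∀ g : ℝ → ℂ, IsWeilTest g →
    HasSum (fun i => weilMellin g (1 / 2 + (γ i : ℂ) * I)) (weilFunctional g)

/-- The right-hand side of the crux: multiplicity of `z` as a non-trivial zero, in `ℕ∞`. -/
def mult (z : ℂ) : ℕ∞ :=
  ZetaZeros.riemannZetaNontrivialZeros.indicator (fun w => (analyticOrderNatAt riemannZeta w : ℕ∞)) z

/-- Sanity: the crux is literally `∀ ι γ, IsWeilSpectrum γ → ∀ z, fibre = mult`. -/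
example : Theses.SpectralTrace.SpectralIsHpSpectrum ↔
    ∀ (ι : Type) (γ : ι → ℝ), IsWeilSpectrum γ →
      ∀ z : ℂ, {i : ι | (1 / 2 : ℂ) + (γ i : ℂ) * I = z}.encard = mult z := Iff.rfl

/-! ## Card B — Fejér projector + Fatou sandwich -/

/-- Dilated and modulated test: `g_{R,T}(x) = R⁻¹ k(x/R) e^{-iTx}`; on the critical line
`ĝ_{R,T}(1/2 + iγ) = k̂(1/2 + iR(γ - T))`, an approximate spectral projector onto `γ = T` as `R → ∞`. -/
def dilMod (k : ℝ → ℂ) (R T : ℝ) : ℝ → ℂ :=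
  fun x => ((R : ℂ)⁻¹) * k (x / R) * cexp (-((T * x : ℝ) : ℂ) * I)

/-- B1: dilation/modulation preserves Weil tests. -/
theorem B1_isWeilTest_dilMod {k : ℝ → ℂ} (hk : IsWeilTest k) {R : ℝ} (hR : 0 < R) (T : ℝ) :
    IsWeilTest (dilMod k R T) := by
  sorry

/-- B2: the spectral side of `g_{R,T}` on the critical line. -/
theorem B2_weilMellin_dilMod (k : ℝ → ℂ) {R : ℝ} (hR : 0 < R) (T γ : ℝ) :
    weilMellin (dilMod k R T) (1 / 2 + (γ : ℂ) * I) =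
      weilMellin k (1 / 2 + ((R * (γ - T) : ℝ) : ℂ) * I) := by
  sorry

/-- B3 (FIRST LEMMA of card B): under RH the zero side of the explicit formula for `g_{R,T}` tends,
as `R → ∞`, to `m(1/2 + iT) · k̂(1/2)` — dominated convergence with the in-tree majorant
`summable_norm_zeroSide_of_le` (`‖k̂(1/2 + iu)‖ ≤ weilDecayW2 0 k / (1 + u²)²`, `norm_weilMellin_le_sq`). -/
theorem B3_zeroSide_fejer_limit (hRH : _root_.RiemannHypothesis) {k : ℝ → ℂ} (hk : IsWeilTest k)
    (T : ℝ) :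
    Tendsto (fun R : ℝ => ∑' ρ : ZetaZeros.riemannZetaNontrivialZeros,
        (riemannZetaZeroOrder (ρ : ℂ) : ℂ) * weilMellin (dilMod k R T) ρ) atTop
      (𝓝 ((ZetaZeros.riemannZetaNontrivialZeros.indicator
          (fun w => ((analyticOrderNatAt riemannZeta w : ℕ) : ℂ)) (1 / 2 + (T : ℂ) * I)) *
        weilMellin k (1 / 2))) := by
  sorry

/-- B4 (Fatou half): every fibre of a Weil spectrum is finite with cardinality at most the
multiplicity (finite partial sums of the non-negative family `|ĥ|²(R(γ_i - T))` are `≤` the total `=`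
zero side, then `R → ∞` with B3; RH from the hypothesis via `weil_criterion_holds`). -/
theorem B4_fibre_le {ι : Type} {γ : ι → ℝ} (hγ : IsWeilSpectrum γ) (T : ℝ) :
    {i : ι | γ i = T}.encard ≤ mult (1 / 2 + (T : ℂ) * I) := by
  sorry

/-- B5 (sandwich, pure summation): pointwise `a ≤ b`, equal weighted sums with a non-negative
weight, and summability of the larger side force `a t = b t` wherever the weight is positive.
Applied with `a = fibre count`, `b = multiplicity`, `w = |ĥ|²(· - T)` and ONE test `k_T`. -/
theorem B5_sandwich {S : Type} (a b w : S → ℝ) (hw : ∀ t, 0 ≤ w t) (ha : ∀ t, 0 ≤ a t)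
    (hab : ∀ t, a t ≤ b t) (hb : Summable fun t => b t * w t)
    (heq : ∑' t, a t * w t = ∑' t, b t * w t) :
    ∀ t, 0 < w t → a t = b t := by
  sorry

/-! ## Card C — characteristic functions of tilted finite measures (`Measure.ext_of_charFun`) -/

/-- The family's counting measure tilted by the weight `w(· - a)`: `Σ_i w(γ_i - a) δ_{γ_i}`. -/
def tiltFamily {ι : Type} (γ : ι → ℝ) (w : ℝ → ℝ) (a : ℝ) : Measure ℝ :=
  Measure.sum fun i : ι => ENNReal.ofReal (w (γ i - a)) • Measure.dirac (γ i)

/-- The zero-counting measure on ordinates, tilted the same way: `Σ_ρ m(ρ) w(Im ρ - a) δ_{Im ρ}`. -/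
def tiltZeros (w : ℝ → ℝ) (a : ℝ) : Measure ℝ :=
  Measure.sum fun ρ : ZetaZeros.riemannZetaNontrivialZeros =>
    (((riemannZetaZeroOrder (ρ : ℂ)).toNat : ℝ≥0∞) * ENNReal.ofReal (w ((ρ : ℂ).im - a))) •
      Measure.dirac (ρ : ℂ).im

/-- The Fejér weight of a test `h`: `w_h(t) = |ĥ(1/2 + it)|² ≥ 0`, the spectral side of `h ⋆ h̃`. -/
def fejerWeight (h : ℝ → ℂ) (t : ℝ) : ℝ := ‖weilMellin h (1 / 2 + (t : ℂ) * I)‖ ^ 2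

/-- C1: both tilted measures are finite (total mass = the trace of ONE positive test, modulated by `a`). -/
theorem C1_isFiniteMeasure (hRH : _root_.RiemannHypothesis) {ι : Type} {γ : ι → ℝ}
    (hγ : IsWeilSpectrum γ) {h : ℝ → ℂ} (hh : IsWeilTest h) (a : ℝ) :
    IsFiniteMeasure (tiltFamily γ (fejerWeight h) a) ∧ IsFiniteMeasure (tiltZeros (fejerWeight h) a) := by
  sorry

/-- C2 (FIRST LEMMA of card C): the two tilted measures have the same characteristic function —
`charFun` at `s` is the trace identity for the translated–modulated test `x ↦ k(x - s) e^{-iax}`,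
`k = h ⋆ h̃`, read on the family side (hypothesis) and on the zero side (explicit formula under RH). -/
theorem C2_charFun_tilt_eq (hRH : _root_.RiemannHypothesis) {ι : Type} {γ : ι → ℝ}
    (hγ : IsWeilSpectrum γ) {h : ℝ → ℂ} (hh : IsWeilTest h) (a : ℝ) :
    charFun (tiltFamily γ (fejerWeight h) a) = charFun (tiltZeros (fejerWeight h) a) := by
  sorry

/-- C3: hence the tilted measures coincide (`MeasureTheory.Measure.ext_of_charFun` on `ℝ`), and
evaluating at a singleton `{t}` with `a := t` (where `w_h(0) = |∫ h|² > 0` for a bump `h ≥ 0`)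
gives fibre count = multiplicity. -/
theorem C3_tilt_eq (hRH : _root_.RiemannHypothesis) {ι : Type} {γ : ι → ℝ}
    (hγ : IsWeilSpectrum γ) {h : ℝ → ℂ} (hh : IsWeilTest h) (a : ℝ) :
    tiltFamily γ (fejerWeight h) a = tiltZeros (fejerWeight h) a := by
  sorry

/-! ## Card D — Laplace/resolvent kernels and the identity theorem (no Weil criterion, no Fourier uniqueness) -/

/-- D1 (FIRST LEMMA of card D, unconditional — no RH): a Weil spectrum has finite Cauchy energy
`Σ_i (1 + γ_i²)^{-2} < ∞` (Fatou along positive-type tests `u_n ⋆ ũ_n` whose spectral sides increase to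
the slowly decaying weight `|û₀(1/2+iγ)|² = ((γ-a)² + b²)^{-2}` of the kinked kernel `u₀ = x e^{-(b+ia)x} 1_{x>0}`,
`b > 1/2`, while `W(u_n ⋆ ũ_n)` stays bounded termwise: polar, prime (`b > 1/2`), Bombieri arch term). -/
theorem D1_summable_cauchyEnergy {ι : Type} {γ : ι → ℝ} (hγ : IsWeilSpectrum γ) :
    Summable fun i => ((1 + (γ i) ^ 2) ^ 2)⁻¹ := by
  sorry

/-- D2: the W-free trace identity extended to the quartic resolvent kernel
`g_z(x) = (x³/6) e^{-izx} 1_{x>0}` (`ĝ_z(s) = (s - 1/2 - iz)^{-4}`), valid for `Im z < -1`: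
`Σ_i (γ_i - z)^{-4} = Σ_ρ m(ρ) (-i(ρ - 1/2) - z)^{-4}` (family side by D1-domination, zero side by
`summable_norm_zeroSide_of_le`; both from the identity on `C_c^∞` tests by mollification + truncation). -/
theorem D2_resolvent_identity {ι : Type} {γ : ι → ℝ} (hγ : IsWeilSpectrum γ) {z : ℂ}
    (hz : z.im < -1) :
    HasSum (fun i => (((γ i : ℂ) - z) ^ 4)⁻¹)
      (∑' ρ : ZetaZeros.riemannZetaNontrivialZeros,
        (riemannZetaZeroOrder (ρ : ℂ) : ℂ) * ((-I * ((ρ : ℂ) - 1 / 2) - z) ^ 4)⁻¹) := by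
  sorry

/-- D3 (payoff, includes RH for free): the left side of D2 is analytic off the real closure of the
family, the right side has a 4th-order pole of positive integer weight at every `Im ρ - i(Re ρ - 1/2)`;
the identity theorem on the lower half-plane forbids poles off `ℝ` (⇒ RH) and matching Laurent
coefficients at real points gives the crux. Stated here as the implication to the crux's conclusion. -/
theorem D3_fibre_eq {ι : Type} {γ : ι → ℝ} (hγ : IsWeilSpectrum γ)
    (hD2 : ∀ z : ℂ, z.im < -1 → HasSum (fun i => (((γ i : ℂ) - z) ^ 4)⁻¹)
      (∑' ρ : ZetaZeros.riemannZetaNontrivialZeros,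
        (riemannZetaZeroOrder (ρ : ℂ) : ℂ) * ((-I * ((ρ : ℂ) - 1 / 2) - z) ^ 4)⁻¹)) :
    ∀ z : ℂ, {i : ι | (1 / 2 : ℂ) + (γ i : ℂ) * I = z}.encard = mult z := by
  sorry

end Summit.RiemannHypothesis.RiemannHypothesis.Cruxes.SpectralIsHpSpectrum.Sketch
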